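import Mathlib
import Summits.CriticalPhenomena.PercolationContinuityZ3.Theorems.PercNonProliferationPolynomialAssembly
import HarnessLib

/-!
# Crux `PercNonProliferation.SubpolynomialBlocking` (stmt-CriticalPhenomena-4446), line `cross-sandwich-flat-seal` — stub `meanSpanningSubpoly_of_subpolynomialBlocking`

Helper file for the crux skeleton of line `cross-sandwich-flat-seal` (lead
prover-line-stmt-CriticalPhenomena-4446-c5-0). Proves exactly the registered stub signature
`meanSpanningSubpoly_of_subpolynomialBlocking`; lands with `--supports stmt-CriticalPhenomena-4446`.

## The statement (the MEAN form of the crux is formally weaker)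

Write `P = P_{p_c(ℤ³)}`, `B(n) = box 3 n`, `u_n = P(no open path inside B(2n) from B(n) to ∂ⁱⁿB(2n))`
(the blocking probability of the crux `SubpolynomialBlocking : ∀ s > 0, ∀ᶠ n, n^{-s} ≤ u_n`), and
`E[N_n] = Σ_{k < |B(n)|} P(∃ k+1 points of B(n), each joined inside B(2n) to ∂ⁱⁿB(2n), pairwise not
joined inside B(2n))` (the mean number of annulus-spanning box-clusters, as the finite sum used by
the route items `MeanCauchySchwarz` / `SpanningBKCap`). Then

  `SpanningBKCap → SubpolynomialBlocking → ∀ s > 0, ∀ᶠ n, E[N_n] ≤ n^s`.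

This is the only way the route `PercNonProliferation` consumes the crux (inside `PolynomialAssembly`):
through the BK cap `E[N_n] ≤ 1/u_n`.

## The argument

`SpanningBKCap` bounds the `k`-th summand by `P(crossing)^{k+1} = (1 - u_n)^{k+1}`, so the truncated
geometric series gives `E[N_n] ≤ 1/u_n` (`polynomialAssembly_sum_le_one_div`; the blocking event is
the complement of the crossing event, a finite union of the measurable events `{x ↔ y in B(2n)}`), and
the crux at exponent `s` gives `1/u_n ≤ 1/n^{-s} = n^s` eventually.
-/

noncomputable section

namespace Summit.CriticalPhenomena.PercolationContinuityZ3.Theorems.SubpolynomialBlocking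

open MeasureTheory Filter Topology
open Literature.Probability.Percolation Literature.Probability.LatticeModels
open Summit.CriticalPhenomena.PercolationContinuityZ3.Theses.PercNonProliferation

/-- **Registered stub `meanSpanningSubpoly_of_subpolynomialBlocking`** (crux stmt-CriticalPhenomena-4446,
line `cross-sandwich-flat-seal`): the BK cap on the spanning count together with the crux
`SubpolynomialBlocking` makes the mean number of annulus-spanning box-clusters sub-polynomial,
`∀ s > 0, ∀ᶠ n, E[N_n] = Σ_{k<|B(n)|} P(k+1 spanning representatives) ≤ n^s`
(`E[N_n] ≤ Σ_k (1-u_n)^{k+1} ≤ 1/u_n ≤ 1/n^{-s} = n^s`). -/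
theorem meanSpanningSubpoly_of_subpolynomialBlocking : SpanningBKCap → Summit.CriticalPhenomena.PercolationContinuityZ3.Theses.PercNonProliferation.SubpolynomialBlocking → ∀ s : ℝ, 0 < s → ∀ᶠ n : ℕ in atTop, (∑ k ∈ Finset.range (box 3 n).card, (bondPercolation (zdGraph 3) (criticalProbI 3)).real {ω | ∃ x : Fin (k + 1) → Site 3, (∀ i, x i ∈ box 3 n) ∧ (∀ i, ∃ y ∈ innerBoundary (zdGraph 3) (box 3 (2 * n)), ω ∈ openConnIn ↑(box 3 (2 * n)) (x i) y) ∧ ∀ i j, i ≠ j → ω ∉ openConnIn ↑(box 3 (2 * n)) (x i) (x j)}) ≤ (n : ℝ) ^ s := by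
  intro hBK hSB s hs
  unfold SpanningBKCap at hBK
  unfold Summit.CriticalPhenomena.PercolationContinuityZ3.Theses.PercNonProliferation.SubpolynomialBlocking
    at hSB
  filter_upwards [hSB s hs, eventually_ge_atTop 1] with n hu hn
  have hn0 : (0 : ℝ) < n := Nat.cast_pos.2 (Nat.succ_le_iff.1 hn)
  have hnpow : 0 < (n : ℝ) ^ (-s) := Real.rpow_pos_of_pos hn0 _
  have hu0 := hnpow.trans_le hu
  calc ∑ k ∈ Finset.range (box 3 n).card, (bondPercolation (zdGraph 3) (criticalProbI 3)).real
          {ω | ∃ x : Fin (k + 1) → Site 3, (∀ i, x i ∈ box 3 n) ∧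
            (∀ i, ∃ y ∈ innerBoundary (zdGraph 3) (box 3 (2 * n)),
              ω ∈ openConnIn ↑(box 3 (2 * n)) (x i) y) ∧
            ∀ i j, i ≠ j → ω ∉ openConnIn ↑(box 3 (2 * n)) (x i) (x j)}
        ≤ 1 / (bondPercolation (zdGraph 3) (criticalProbI 3)).real
            {ω | ¬ ∃ x ∈ box 3 n, ∃ y ∈ innerBoundary (zdGraph 3) (box 3 (2 * n)),
              ω ∈ openConnIn ↑(box 3 (2 * n)) x y} :=
      polynomialAssembly_sum_le_one_div _
        (polynomialAssembly_measurableSet_exists₂ _ _ fun x _ y _ =>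
          DCT16.measurableSet_openConnIn _ x y)
        (fun k => hBK (criticalProbI 3) k n) rfl hu0 _
    _ ≤ 1 / (n : ℝ) ^ (-s) := one_div_le_one_div_of_le hnpow hu
    _ = (n : ℝ) ^ s := by rw [Real.rpow_neg hn0.le, one_div, inv_inv]

/-- **Name-keyed reading.** The same implication with the mean spanning number bounded through the
route's own blocking probability first: under `SpanningBKCap`, at every scale `n` with `u_n > 0` the mean
spanning number is at most `1/u_n` (the BK cap summed as a geometric series; no input from the crux). -/
theorem meanSpanning_le_one_div_blocking (hBK : SpanningBKCap) (n : ℕ)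
    (hu0 : 0 < (bondPercolation (zdGraph 3) (criticalProbI 3)).real
      {ω | ¬ ∃ x ∈ box 3 n, ∃ y ∈ innerBoundary (zdGraph 3) (box 3 (2 * n)),
        ω ∈ openConnIn ↑(box 3 (2 * n)) x y}) :
    (∑ k ∈ Finset.range (box 3 n).card, (bondPercolation (zdGraph 3) (criticalProbI 3)).real
        {ω | ∃ x : Fin (k + 1) → Site 3, (∀ i, x i ∈ box 3 n) ∧
          (∀ i, ∃ y ∈ innerBoundary (zdGraph 3) (box 3 (2 * n)),
            ω ∈ openConnIn ↑(box 3 (2 * n)) (x i) y) ∧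
          ∀ i j, i ≠ j → ω ∉ openConnIn ↑(box 3 (2 * n)) (x i) (x j)}) ≤
      1 / (bondPercolation (zdGraph 3) (criticalProbI 3)).real
        {ω | ¬ ∃ x ∈ box 3 n, ∃ y ∈ innerBoundary (zdGraph 3) (box 3 (2 * n)),
          ω ∈ openConnIn ↑(box 3 (2 * n)) x y} := by
  unfold SpanningBKCap at hBK
  exact polynomialAssembly_sum_le_one_div _
    (polynomialAssembly_measurableSet_exists₂ _ _ fun x _ y _ =>
      DCT16.measurableSet_openConnIn _ x y)
    (fun k => hBK (criticalProbI 3) k n) rfl hu0 _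

end Summit.CriticalPhenomena.PercolationContinuityZ3.Theorems.SubpolynomialBlocking

end
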